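/-
Copyright (c) 2026. All rights reserved.
Released under Apache 2.0 license as described in the file LICENSE.
Authors: abc-iut cell, seat abc-iut-w6-d025 (gen 3; block C / W6, row «COR36-JOINT-TELE»).
-/
import Literature.AnabelianGeometry.AbsoluteAnabelian.DiagramOverHomotopies

/-!
# Homotopies over the structure functors: change of structure data ([AbsTopIII] Def. 3.5, toolkit V)

S. Mochizuki, *Topics in Absolute Anabelian Geometry III*, Def. 3.5 (ii)–(iv) pp. 75–76 and
Rmk. 3.5.1 p. 78 (manuscript `paper:url-5493eb38cbb7`, bib key `MochizukiAbsTopIII2015`); proof of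
Cor. 3.6 (i)–(iii), p. 80–81 ("the algorithms of Corollary 1.10 are group-theoretic" — every functor of the
diagram lies over the base, "the various Galois groups that appear remain 'undisturbed'").  Continuation of
`DiagramLifts.lean` (seat abc-iut-L4-t5: structure functors `OverData`, the isomorphisms `pathIso`, the
lifts) and `DiagramOverHomotopies.lean` (this seat, gen 2: `OverData.IsOver`).

The structure functors of the telecore diagram `𝒟_An` of Cor. 3.6 (ii) were chosen TWICE in the cell's
files: over `𝒳` (seat abc-iut-L4-t5, `anOver`, for items (ii)/(v)) and over `ℰ` (this seat, `teleOverE`,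
for the telecore half of item (iii)).  To compare the resulting lifts one needs to move over-ness of a
homotopy ALONG A CHANGE OF STRUCTURE DATA.  This file provides the two generic moves:

* `OverData.map F` (post-composition of every structure functor with `F : 𝒞 ⥤ 𝒞'`):
  `map_pathIso_hom_app` / `map_pathIso_inv_app` (the `pathIso` of `O.map F` are `F` applied to those
  of `O`) and `IsOver.map` (an over-homotopy stays over after post-composition);
* `OverData.OverIso O O'` — an ISOMORPHISM OF STRUCTURE DATA over the same base: natural isomorphisms
  `β_v : N_v ≅ N'_v` compatible with the `μ_e` (`μ'_e ∘ (𝒟_e ◁ β_{v₂}) = β_{v₁} ∘ μ_e`, componentwise);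
  `OverIso.pathIso_hom_app` (the `pathIso` correspond under `β`, by induction on the path),
  `IsOver.overIso` (over-ness is invariant), `OverIso.lift_eq` (the lifts at a vertex whose two
  structure functors are fully faithful AGREE — uniqueness of over-homotopies, `IsOver.eq_lift`).

Also an extensionality principle for families of homotopies (`HomotopyFamily.ext_of_iff`: equal boundary
sets and equal homotopies).  Pure category theory (`eqToHom` bookkeeping); no claim of the paper is
asserted.  Consumer: `AbsTopIII/FrobeniusPictureMLFTelecoreAgreement.lean` (the telecores `𝔗_An` over `𝒳`
and over `ℰ` carry the same family `𝒥`).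
-/

namespace Literature.AnabelianGeometry.AbsoluteAnabelian

open _root_.CategoryTheory _root_.Quiver

universe v u w

namespace DiagramOfCategories

variable {V : Type w} [Quiver.{v} V] {D : DiagramOfCategories.{v, u, w} V}

/-! ### Extensionality of families of homotopies -/

/-- Two families of homotopies with the same boundary set and the same homotopies are equal (the
remaining fields of Def. 3.5 (ii) are properties). [cite: MochizukiAbsTopIII2015, Definition 3.5 (ii) p.75] -/
theorem HomotopyFamily.ext_of_iff {H K : D.HomotopyFamily}
    (hE : ∀ ⦃a b : V⦄ (p q : Path a b), H.E p q ↔ K.E p q)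
    (hη : ∀ ⦃a b : V⦄ ⦃p q : Path a b⦄ (h : H.E p q), H.η h = K.η ((hE p q).1 h)) : H = K := by
  obtain ⟨E, hsat, η, h₁, h₂, h₃⟩ := H
  obtain ⟨E', hsat', η', h₁', h₂', h₃'⟩ := K
  have hEE : E = E' := by
    funext a b p q
    exact propext (hE p q)
  subst hEE
  have hηη : η = η' := by
    funext a b p q h
    exact hη h
  subst hηη
  rfl

/-- Two restrictions to the same boundary set agree as soon as the underlying homotopies agree there.
[cite: MochizukiAbsTopIII2015, Definition 3.5 (ii) p.75] -/
theorem HomotopyFamily.restrictBoundary_eq_restrictBoundary {H K : D.HomotopyFamily}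
    {E' : ∀ ⦃a b : V⦄, Path a b → Path a b → Prop} {hE' : IsSaturated E'}
    {hsub : ∀ ⦃a b : V⦄ ⦃p q : Path a b⦄, E' p q → H.E p q}
    {hsub' : ∀ ⦃a b : V⦄ ⦃p q : Path a b⦄, E' p q → K.E p q}
    (hη : ∀ ⦃a b : V⦄ ⦃p q : Path a b⦄ (h : E' p q), H.η (hsub h) = K.η (hsub' h)) :
    H.restrictBoundary E' hE' hsub = K.restrictBoundary E' hE' hsub' :=
  HomotopyFamily.ext_of_iff (fun _ _ _ _ => Iff.rfl) hη

namespace OverData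

variable {C : Type u} [Category.{v} C] {C' : Type u} [Category.{v} C']

/-! ### Post-composition of the structure functors (`OverData.map`) -/

/-- The `pathIso` of the post-composed structure data `O.map F` are `F` applied to those of `O`,
componentwise. [cite: MochizukiAbsTopIII2015, Definition 3.5 (i) p.75] -/
theorem map_pathIso_hom_app (O : D.OverData C) (F : C ⥤ C') {a b : V} (p : Path a b) (x : D.obj a) :
    ((O.map F).pathIso p).hom.app x = F.map ((O.pathIso p).hom.app x) := by
  induction p with
  | nil =>
    rw [pathIso_nil_app, pathIso_nil_app, eqToHom_map]
    rfl
  | cons p e ih =>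
    rw [pathIso_cons_app, pathIso_cons_app, ih, F.map_comp, F.map_comp, eqToHom_map]
    rfl

/-- The same at the level of the isomorphisms `(pathIso γ)_x`. [cite: MochizukiAbsTopIII2015, Definition 3.5 (i) p.75] -/
theorem map_pathIso_app (O : D.OverData C) (F : C ⥤ C') {a b : V} (p : Path a b) (x : D.obj a) :
    ((O.map F).pathIso p).app x = F.mapIso ((O.pathIso p).app x) := by
  ext
  exact map_pathIso_hom_app O F p x

/-- The inverse components likewise. [cite: MochizukiAbsTopIII2015, Definition 3.5 (i) p.75] -/
theorem map_pathIso_inv_app (O : D.OverData C) (F : C ⥤ C') {a b : V} (p : Path a b) (x : D.obj a) :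
    ((O.map F).pathIso p).inv.app x = F.map ((O.pathIso p).inv.app x) := by
  have h := congrArg Iso.inv (map_pathIso_app O F p x)
  exact h

/-- **Over-ness is stable under post-composition of the base**: a homotopy lying over the structure
functors `N_v : 𝒟_v ⥤ 𝒞` lies over the `N_v ⋙ F`. [cite: MochizukiAbsTopIII2015, Remark 3.5.1 p.78] -/
theorem IsOver.map {O : D.OverData C} (F : C ⥤ C') {a b : V} {P Q : Path a b}
    {θ : D.pathFunctor P ⟶ D.pathFunctor Q} (h : O.IsOver P Q θ) : (O.map F).IsOver P Q θ :=
  isOver_of_map_app fun x => by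
    rw [map_pathIso_hom_app, map_pathIso_inv_app]
    have h2 := congrArg F.map (h.map_app x)
    erw [F.map_comp] at h2
    exact h2

/-! ### Isomorphic structure data over the same base -/

/-- **An isomorphism of structure data** `O ≅ O'` over the same base `𝒞`: natural isomorphisms
`β_v : N_v ≅ N'_v` of the structure functors at every vertex, compatible with the isomorphisms
`μ_e : 𝒟_e ⋙ N_{v₂} ≅ N_{v₁}` exhibiting the edge functors as lying over `𝒞` — componentwise
`μ'_e(y) = β_{v₁}(y) ∘ μ_e(y) ∘ β_{v₂}(𝒟_e y)⁻¹` (Rmk. 3.5.1: two presentations of the "constant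
portion" under the diagram). [cite: MochizukiAbsTopIII2015, Remark 3.5.1 p.78] -/
structure OverIso (O O' : D.OverData C) : Type (max u v w) where
  /-- The isomorphisms of structure functors `β_v : N_v ≅ N'_v`. -/
  β : ∀ a : V, O.N a ≅ O'.N a
  /-- Compatibility with the `μ_e`, componentwise, in conjugation form. -/
  comm : ∀ {a b : V} (e : a ⟶ b) (y : D.obj a),
    (O'.μ e).hom.app y = (β b).inv.app ((D.map e).obj y) ≫ (O.μ e).hom.app y ≫ (β a).hom.app y

namespace OverIso

variable {O O' : D.OverData C}

/-- Conjugating an `eqToHom` by a natural isomorphism along an equality of objects gives the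
`eqToHom` (bookkeeping). [folklore] -/
private theorem inv_eqToHom_hom {A : Type u} [Category.{v} A] {F G : A ⥤ C} (β : F ≅ G) {y x : A}
    (h : y = x) :
    β.inv.app y ≫ eqToHom (congrArg F.obj h) ≫ β.hom.app x = eqToHom (congrArg G.obj h) := by
  subst h
  simp

/-- Components of the inverse of a natural isomorphism commute with `eqToHom` along an equality of
objects (bookkeeping). [folklore] -/
private theorem eqToHom_inv_app {A : Type u} [Category.{v} A] {F G : A ⥤ C} (β : F ≅ G) {y x : A}
    (h : y = x) :
    eqToHom (congrArg G.obj h) ≫ β.inv.app x = β.inv.app y ≫ eqToHom (congrArg F.obj h) := by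
  subst h
  simp

/-- Bookkeeping for the induction step of `pathIso_hom_app` (all objects free). [folklore] -/
private theorem cons_algebra {n₀ n₀' n₁ n₁' m m' k k' : C} (ε' : n₀' ⟶ n₁') (bi₁ : n₁' ⟶ n₁)
    (μ : n₁ ⟶ m) {bh : m ⟶ m'} {bi : m' ⟶ m} (π : m ⟶ k) (ba : k ⟶ k') (bi₀ : n₀' ⟶ n₀) (ε : n₀ ⟶ n₁)
    (hb : bh ≫ bi = 𝟙 _) (hε : ε' ≫ bi₁ = bi₀ ≫ ε) :
    ε' ≫ (bi₁ ≫ μ ≫ bh) ≫ (bi ≫ π ≫ ba) = bi₀ ≫ (ε ≫ μ ≫ π) ≫ ba := by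
  simp only [Category.assoc]
  rw [reassoc_of% hb, ← Category.assoc, hε, Category.assoc]

/-- **The `pathIso` correspond under an isomorphism of structure data**:
`pathIso'_γ(x) = β_{v₁}(x) ∘ pathIso_γ(x) ∘ β_{v₂}(𝒟_[γ] x)⁻¹` (induction on `γ`).
[cite: MochizukiAbsTopIII2015, Definition 3.5 (i) p.75] -/
theorem pathIso_hom_app (I : OverIso O O') {a b : V} (p : Path a b) (x : D.obj a) :
    (O'.pathIso p).hom.app x =
      (I.β b).inv.app ((D.pathFunctor p).obj x) ≫ (O.pathIso p).hom.app x ≫ (I.β a).hom.app x := by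
  induction p with
  | nil =>
    rw [pathIso_nil_app, pathIso_nil_app]
    exact (inv_eqToHom_hom (I.β a) (Functor.congr_obj (D.pathFunctor_nil a) x)).symm
  | cons p e ih =>
    rename_i b' c
    rw [pathIso_cons_app, pathIso_cons_app, I.comm e, ih]
    exact cons_algebra _ _ _ _ _ _ _ (Iso.hom_inv_id_app (I.β b') _)
      (eqToHom_inv_app (I.β c) (Functor.congr_obj (D.pathFunctor_cons p e) x))

/-- Bookkeeping: the inverse of a conjugated isomorphism (all objects free). [folklore] -/
private theorem inv_of_hom_conj {M M' K K' : C} (i : M ≅ K) (u : M ≅ M') (w : K ≅ K') (i' : M' ≅ K')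
    (h : i'.hom = u.inv ≫ i.hom ≫ w.hom) : i'.inv = w.inv ≫ i.inv ≫ u.hom := by
  rw [← cancel_epi i'.hom, i'.hom_inv_id, h]
  simp

/-- The inverses: `pathIso'_γ(x)⁻¹ = β_{v₂}(𝒟_[γ] x) ∘ pathIso_γ(x)⁻¹ ∘ β_{v₁}(x)⁻¹`.
[cite: MochizukiAbsTopIII2015, Definition 3.5 (i) p.75] -/
theorem pathIso_inv_app (I : OverIso O O') {a b : V} (p : Path a b) (x : D.obj a) :
    (O'.pathIso p).inv.app x =
      (I.β a).inv.app x ≫ (O.pathIso p).inv.app x ≫ (I.β b).hom.app ((D.pathFunctor p).obj x) :=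
  inv_of_hom_conj ((O.pathIso p).app x) ((I.β b).app _) ((I.β a).app x) ((O'.pathIso p).app x)
    (I.pathIso_hom_app p x)

/-- Bookkeeping for `isOver` (all objects free). [folklore] -/
private theorem isOver_algebra {A A' M₁ M₁' M₂ M₂' : C} {nθ : M₁ ⟶ M₂} {π₁ : M₁ ⟶ A} {π₂ : A ⟶ M₂}
    (b₁ : M₁' ⟶ M₁) (b₂ : M₂ ⟶ M₂') {ba : A ⟶ A'} {bai : A' ⟶ A} (hθ : nθ = π₁ ≫ π₂)
    (ha : ba ≫ bai = 𝟙 _) : b₁ ≫ nθ ≫ b₂ = (b₁ ≫ π₁ ≫ ba) ≫ (bai ≫ π₂ ≫ b₂) := by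
  subst hθ
  simp only [Category.assoc]
  rw [reassoc_of% ha]

/-- **Over-ness is invariant under isomorphism of structure data.**
[cite: MochizukiAbsTopIII2015, Remark 3.5.1 p.78] -/
theorem isOver (I : OverIso O O') {a b : V} {P Q : Path a b} {θ : D.pathFunctor P ⟶ D.pathFunctor Q}
    (h : O.IsOver P Q θ) : O'.IsOver P Q θ :=
  isOver_of_map_app fun x => by
    have nat := (I.β b).hom.naturality (θ.app x)
    -- `N'_b(θ_x) = β⁻¹ ∘ N_b(θ_x) ∘ β`
    have key : (O'.N b).map (θ.app x) =
        (I.β b).inv.app ((D.pathFunctor P).obj x) ≫ (O.N b).map (θ.app x) ≫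
          (I.β b).hom.app ((D.pathFunctor Q).obj x) := by
      rw [nat, Iso.inv_hom_id_app_assoc]
    rw [key, I.pathIso_hom_app P x, I.pathIso_inv_app Q x]
    exact isOver_algebra _ _ (h.map_app x) (Iso.hom_inv_id_app (I.β a) x)

/-- **The lifts agree**: at a vertex whose structure functors are fully faithful for both data, the
lift of a co-verticial pair through `N_w` equals the lift through `N'_w` (uniqueness of the
over-homotopy, `IsOver.eq_lift`). [cite: MochizukiAbsTopIII2015, Remark 3.5.1 p.78] -/
theorem lift_eq (I : OverIso O O') {a w : V} (hw : (O.N w).FullyFaithful) (hw' : (O'.N w).FullyFaithful)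
    (p q : Path a w) : O.lift hw p q = O'.lift hw' p q :=
  (I.isOver (O.isOver_lift hw p q)).eq_lift hw'

end OverIso

/-- **Over `N_v` implies over `N_v ⋙ F`, then over any isomorphic data**: the composite move used for
`𝒟_An` (structure functors over `𝒳`, post-composed with `𝒳 → ℰ`, compared with the structure functors
over `ℰ`). [cite: MochizukiAbsTopIII2015, Remark 3.5.1 p.78] -/
theorem IsOver.map_overIso {O : D.OverData C} {O' : D.OverData C'} (F : C ⥤ C')
    (I : OverIso (O.map F) O') {a b : V} {P Q : Path a b} {θ : D.pathFunctor P ⟶ D.pathFunctor Q}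
    (h : O.IsOver P Q θ) : O'.IsOver P Q θ :=
  I.isOver (h.map F)

/-- **The lifts through `N_w` and through `N'_w` agree** whenever `O.map F ≅ O'` and both structure
functors at `w` are fully faithful. [cite: MochizukiAbsTopIII2015, Remark 3.5.1 p.78] -/
theorem lift_eq_of_map_overIso {O : D.OverData C} {O' : D.OverData C'} (F : C ⥤ C')
    (I : OverIso (O.map F) O') {a w : V} (hw : (O.N w).FullyFaithful) (hw' : (O'.N w).FullyFaithful)
    (p q : Path a w) : O.lift hw p q = O'.lift hw' p q :=
  (I.isOver ((O.isOver_lift hw p q).map F)).eq_lift hw'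

end OverData

end DiagramOfCategories

end Literature.AnabelianGeometry.AbsoluteAnabelian
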